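import Summits.ValiantsHypothesis.Statement
import Summits.ValiantsHypothesis.ValiantsHypothesis.Theorems.HubHub
import Summits.ValiantsHypothesis.ValiantsHypothesis.Theorems.BorderApolarityGctBridge
import Summits.ValiantsHypothesis.ValiantsHypothesis.Theorems.RealTauRealVnTransfer
import Literature.StrongHypotheses.ValiantsHypothesis
import Literature.Computability.AlgebraicComplexity.ValiantClassesProofs
import Literature.Computability.AlgebraicComplexity.ValiantConjectureProofs
import Literature.Computability.AlgebraicComplexity.ValiantConjectureEquivProofs
import Literature.Computability.AlgebraicComplexity.ValiantConjectureCompleteCriterion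
import Literature.Computability.AlgebraicComplexity.ValiantHCCompleteness
import Literature.Computability.AlgebraicComplexity.VPDeterminantalQPProofs
import Literature.Computability.AlgebraicComplexity.DeterminantalComplexityProofs
import Literature.Computability.AlgebraicComplexity.OrbitClosureProofs
import Literature.Computability.AlgebraicComplexity.GCTObstructions
import Literature.Computability.AlgebraicComplexity.NewtonPolygonTauTransfer
import Literature.Computability.AlgebraicComplexity.NewtonPolygonTauProofs
import Literature.Computability.AlgebraicComplexity.ValiantBooleanBridgeBurgisserHolds
import Literature.Computability.AlgebraicComplexity.RazElusiveGeneralRouteProofs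
import Literature.Computability.Complexity.AdviceBasics
import Literature.Computability.Complexity.NPClosureProofs
import HarnessLib
import HarnessLib.Audit.TribunalTags

/-!
# ValiantsHypothesis — bridges of the Strong-Hypothesis Library (D-0034, operator file kind)

For every hypothesis / criterion `H` registered in `Literature/StrongHypotheses/ValiantsHypothesis.lean`
(all tagged `@[strong_hypothesis "ValiantsHypothesis.ValiantsHypothesis"]`) exactly ONE bridge to the ROOT
problem decl `ValiantsHypothesis` (`= Literature.PNP.ValiantHypothesis ℂ = (VP ℂ ≠ VNP ℂ)`), tagged
`@[summit_bridge "ValiantsHypothesis.ValiantsHypothesis"]`: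

| `H` | relation | bridge |
|---|---|---|
| `ExtendedValiantHypothesisComplex` | stronger | LANDED `extendedValiantHypothesisComplex_implies` |
| `DcPerSuperQuasipolynomial` | stronger (≡ EVH) | LANDED `dcPerSuperQuasipolynomial_implies` |
| `MulmuleySohoniConjectureQP` | stronger | LANDED `mulmuleySohoniConjectureQP_implies` (`gctBridge_proof`) |
| `BorderDcPerSuperQuasipolynomial` | stronger | LANDED `borderDcPerSuperQuasipolynomial_implies` |
| `GCTMultiplicityObstructionsQP` | stronger | LANDED `gctMultiplicityObstructionsQP_implies` |
| `KPTT.newtonTauWeak` | stronger | LANDED `newtonTauWeak_implies` (`KPTT.theorem1_holds`) |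
| `KPTT.newtonTauConjecture` | stronger | LANDED `newtonTauConjecture_implies` |
| `TavenasRefinedRealTauConjecture` | stronger | LANDED `tavenasRefinedRealTauConjecture_implies` (`Theses.RealTau.closes`) |
| `KoiranRealTauConjecture` | stronger | LANDED `koiranRealTauConjecture_implies` |
| `ShubSmaleTauConjecture` | not known `≥ P` | NONE (prints only `VP⁰ ≠ VNP⁰`, Bürgisser 2009) |
| `ERHAndNPNotSubsetPPoly` | stronger | LANDED `erhAndNPNotSubsetPPoly_implies` (Bürgisser 2000 TCS Cor. 1.2(1)) |
| `ERHAndPPNotSubsetPPoly` | stronger | PRINTED `ERHAndPPNotSubsetPPolyImpliesValiantsHypothesis` |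
| `PerNotPComputableComplex` | equivalent | LANDED `perNotPComputableComplex_iff` |
| `HCNotPComputableComplex` | equivalent | LANDED `hcNotPComputableComplex_iff` |
| `PerNotPComputableReal` | equivalent | LANDED `perNotPComputableReal_iff` |

All landed bridges are short compositions of PROVED tree theorems (no named fact is consumed as a
hypothesis); axioms ⊆ {propext, Classical.choice, Quot.sound}. No summit-side hypothesis of this summit
needed tagging here (route cruxes are deliberately not tagged, D-0034).
-/

noncomputable section

-- summit directory = problem directory (single-conjunct summit): duplicated namespace component intended
set_option linter.dupNamespace false

open Literature.Computability.AlgebraicComplexity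
open Literature.StrongHypotheses.ValiantsHypothesis

namespace Summit.ValiantsHypothesis.StrongHypotheses

/-! ### Extended Valiant Hypothesis and determinantal forms -/

/-- **EVH over `ℂ` ⟹ Valiant's hypothesis over `ℂ`**: if `VP ℂ = VNP ℂ` then `VNP ℂ = VP ℂ ⊆ VQP ℂ`
(`VP_subset_VQP_holds`, Bürgisser 2000 §2.5), contradicting `¬ (VNP ℂ ⊆ VQP ℂ)`.
(BCS 1997, §21.5: (21.32) strengthens (21.19).) [cite: BurgisserClausenShokrollahi1997, (21.32) with (21.19)] -/
@[summit_bridge "ValiantsHypothesis.ValiantsHypothesis"]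
theorem extendedValiantHypothesisComplex_implies :
    ExtendedValiantHypothesisComplex → _root_.ValiantsHypothesis := by
  intro hE
  have hE' : ¬ (VNP ℂ ⊆ VQP ℂ) := hE
  show VP ℂ ≠ VNP ℂ
  intro hEq
  apply hE'
  intro F hF
  have hF' : F ∈ VP ℂ := by rw [hEq]; exact hF
  exact VP_subset_VQP_holds ℂ hF'

/-- **`dc(per_n)` not qp-bounded ⟹ Valiant's hypothesis over `ℂ`**: a `VP` family has quasi-polynomially
bounded determinantal complexity (BCS 1997 Cor. (21.40), tree
`isQPBounded_determinantalComplexity_of_isVPFamily_holds`), so the permanent family is not a `VP` family,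
and the hub lemma (`perFamily ∈ VNP`, Valiant 1979) concludes. [cite: BurgisserClausenShokrollahi1997, Cor. (21.40)] -/
@[summit_bridge "ValiantsHypothesis.ValiantsHypothesis"]
theorem dcPerSuperQuasipolynomial_implies :
    DcPerSuperQuasipolynomial → _root_.ValiantsHypothesis := by
  intro h
  refine Summit.ValiantsHypothesis.Hub.valiantsHypothesis_of_not_isVPFamily_per ?_
    (mem_VP_ofFintype_iff_holds _) (perFamily_mem_VNP_holds ℂ)
  intro hVP
  exact h (isQPBounded_determinantalComplexity_of_isVPFamily_holds _ hVP)

/-! ### GCT -/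

/-- **Quasi-polynomial Mulmuley–Sohoni ⟹ Valiant's hypothesis over `ℂ`** (Mulmuley–Sohoni 2001 Prop. 4.4
with BCS 1997 Cor. (21.40)): the tree's `gctBridge_proof`, whose antecedent is this hypothesis verbatim.
[cite: MulmuleySohoniSIAM2001, Prop. 4.4] -/
@[summit_bridge "ValiantsHypothesis.ValiantsHypothesis"]
theorem mulmuleySohoniConjectureQP_implies :
    MulmuleySohoniConjectureQP → _root_.ValiantsHypothesis :=
  fun h => Summit.ValiantsHypothesis.ValiantsHypothesis.Theorems.BorderApolarityGctBridge.gctBridge_proof h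

/-- **`\underline{dc}(per_n)` not qp-bounded ⟹ Valiant's hypothesis over `ℂ`**: a qp bound on `dc(per_n)`
with constant `c` bounds `\underline{dc}(per_n) ≤ max (dc per_n) (max n 1) ≤ 2^{(log₂ n + (c+1))^{c+1}}`
(attainment and padding of `dc`, then Mulmuley–Sohoni 2001 Prop. 4.4 in the form
`borderDetComplexityPer_le_of_hasDetRepr_holds`), so `\underline{dc}` is qp-bounded with constant `c + 1`;
hence the hypothesis gives `DcPerSuperQuasipolynomial`. [cite: MulmuleySohoniSIAM2001, Prop. 4.4] -/
@[summit_bridge "ValiantsHypothesis.ValiantsHypothesis"]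
theorem borderDcPerSuperQuasipolynomial_implies :
    BorderDcPerSuperQuasipolynomial → _root_.ValiantsHypothesis := by
  intro h
  apply dcPerSuperQuasipolynomial_implies
  rintro ⟨c, hc⟩
  have h' : ¬ IsQPBounded (borderDetComplexityPer ℂ) := h
  apply h'
  refine ⟨c + 1, fun n => ?_⟩
  set t := Literature.Computability.AlgebraicComplexity.determinantalComplexity (perPoly (Fin n) ℂ)
    with ht
  set m := max t (max n 1) with hm
  haveI : NeZero m := NeZero.of_pos (by omega)
  have hnm : n ≤ m := by omega
  have htm : t ≤ m := le_max_left _ _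
  have hrep : HasDetRepr (perPoly (Fin n) ℂ) m :=
    HasDetRepr.mono_holds (hasDetRepr_determinantalComplexity_holds _) htm
  have hle : borderDetComplexityPer ℂ n ≤ m := borderDetComplexityPer_le_of_hasDetRepr_holds hrep hnm
  have h1 : t ≤ 2 ^ ((Nat.log 2 n + (c + 1)) ^ (c + 1)) :=
    (hc n).trans (Nat.pow_le_pow_right (by norm_num)
      (Summit.ValiantsHypothesis.ValiantsHypothesis.Theorems.BorderApolarityGctBridge.add_pow_le_add_succ_pow_succ
        _ _))
  have h2 : n ≤ 2 ^ ((Nat.log 2 n + (c + 1)) ^ (c + 1)) :=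
    Summit.ValiantsHypothesis.ValiantsHypothesis.Theorems.BorderApolarityGctBridge.le_two_pow_log_add_succ_pow
      n c
  have h3 : 1 ≤ 2 ^ ((Nat.log 2 n + (c + 1)) ^ (c + 1)) := Nat.one_le_two_pow
  omega

/-- **Multiplicity obstructions in the qp window ⟹ Valiant's hypothesis over `ℂ`**: an obstruction in
any degree `d` excludes `X₀₀^{m-n} per_n ∈ \overline{GL · det_m}`
(`not_hasMultiplicityObstruction_of_mem_orbitClosure`; Bürgisser–Ikenmeyer–Panova 2019 §1), giving
`MulmuleySohoniConjectureQP`. [cite: BurgisserIkenmeyerPanovaJAMS2019, §1] -/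
@[summit_bridge "ValiantsHypothesis.ValiantsHypothesis"]
theorem gctMultiplicityObstructionsQP_implies :
    GCTMultiplicityObstructionsQP → _root_.ValiantsHypothesis := by
  intro h
  apply mulmuleySohoniConjectureQP_implies
  intro c
  obtain ⟨n₀, h₀⟩ := h c
  refine ⟨n₀, fun n hn m _ hnm hm hmem => ?_⟩
  obtain ⟨d, hd⟩ := h₀ n hn m hnm hm
  exact not_hasMultiplicityObstruction_of_mem_orbitClosure hmem d hd

/-! ### Newton-polygon τ-conjecture (KPTT 2015) -/

/-- **Weak Newton-polygon τ-conjecture ⟹ Valiant's hypothesis over `ℂ`** (Koiran–Portier–Tavenas–Thomassé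
2015, Thm. 1, discharged in tree as `KPTT.theorem1_holds`: the permanent family is not a `VP` family;
then the hub lemma). [cite: KoiranPortierTavenasThomasse2015, Theorem 1] -/
@[summit_bridge "ValiantsHypothesis.ValiantsHypothesis"]
theorem newtonTauWeak_implies : KPTT.newtonTauWeak → _root_.ValiantsHypothesis := by
  intro hW
  exact Summit.ValiantsHypothesis.Hub.valiantsHypothesis_of_not_isVPFamily_per (KPTT.theorem1_holds hW)
    (mem_VP_ofFintype_iff_holds _) (perFamily_mem_VNP_holds ℂ)

/-- **Newton-polygon τ-conjecture ⟹ Valiant's hypothesis over `ℂ`**: Conj. 1 implies its weak form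
(`KPTT.newtonTauWeak_of_newtonTauConjecture`), then `newtonTauWeak_implies`.
[cite: KoiranPortierTavenasThomasse2015, Conjecture 1 with Theorem 1] -/
@[summit_bridge "ValiantsHypothesis.ValiantsHypothesis"]
theorem newtonTauConjecture_implies : KPTT.newtonTauConjecture → _root_.ValiantsHypothesis :=
  fun h => newtonTauWeak_implies (KPTT.newtonTauWeak_of_newtonTauConjecture h)

/-! ### Real τ-conjectures (Koiran 2011; Tavenas 2014) -/

/-- **Tavenas' refined real τ-conjecture ⟹ Valiant's hypothesis over `ℂ`** (Tavenas 2014, Thm. 3.38 with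
constants + realification): the deciding theorem of route `RealTau` (`Theses.RealTau.closes`, whose crux
`RealTauRefined` is this hypothesis verbatim) applied to the landed with-constants transfer for `V_n`
(`realVnTransfer_proof`). [cite: Tavenas2014, Thm. 3.38] -/
@[summit_bridge "ValiantsHypothesis.ValiantsHypothesis"]
theorem tavenasRefinedRealTauConjecture_implies :
    TavenasRefinedRealTauConjecture → _root_.ValiantsHypothesis :=
  fun h => Summit.ValiantsHypothesis.ValiantsHypothesis.Theses.RealTau.closes h
    Summit.ValiantsHypothesis.ValiantsHypothesis.Theorems.RealTauRealVnTransfer.realVnTransfer_proof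

/-- `m + 2 ≤ 2^(m+1)`. [folklore] -/
theorem add_two_le_two_pow_succ (m : ℕ) : m + 2 ≤ 2 ^ (m + 1) := by
  induction m with
  | zero => norm_num
  | succ n ih => rw [pow_succ]; omega

/-- **Koiran's real τ-conjecture ⟹ Valiant's hypothesis over `ℂ`**: Koiran's bound `(k+m+t+2)^c` implies
Tavenas' refined bound `2^{c(m+1)} (k+t+2)^c` (as `k+m+t+2 ≤ 2^{m+1}(k+t+2)`; Tavenas 2014 §3.2, the
route's support item `OfKoiran`), then `tavenasRefinedRealTauConjecture_implies`.
[cite: Tavenas2014, Thm. 3.38 with Conj. 3.2 ⟹ Conj. 3.23] -/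
@[summit_bridge "ValiantsHypothesis.ValiantsHypothesis"]
theorem koiranRealTauConjecture_implies : KoiranRealTauConjecture → _root_.ValiantsHypothesis := by
  intro h
  apply tavenasRefinedRealTauConjecture_implies
  obtain ⟨c, hc⟩ := h
  refine ⟨c, fun k m t f hf hF => (hc k m t f hf hF).trans ?_⟩
  have h1 : k + m + t + 2 ≤ 2 ^ (m + 1) * (k + t + 2) :=
    calc k + m + t + 2 ≤ (m + 2) * (k + t + 2) := by nlinarith
      _ ≤ 2 ^ (m + 1) * (k + t + 2) := Nat.mul_le_mul_right _ (add_two_le_two_pow_succ m)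
  calc (k + m + t + 2) ^ c ≤ (2 ^ (m + 1) * (k + t + 2)) ^ c := Nat.pow_le_pow_left h1 c
    _ = 2 ^ (c * (m + 1)) * (k + t + 2) ^ c := by rw [mul_pow, ← pow_mul, Nat.mul_comm (m + 1) c]

/-! ### Boolean hypotheses (Bürgisser 2000, "Cook's versus Valiant's hypothesis") -/

/-- **GRH ∧ `NP ⊄ P/poly` ⟹ Valiant's hypothesis over `ℂ`** (Bürgisser, TCS 235 (2000), Cor. 1.2(1);
book Cor. 4.6(1)): if `VP ℂ = VNP ℂ` then under GRH `P/poly = NP/poly` (tree, discharged: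
`PPoly_eq_polyAdvice_NP_of_VP_eq_VNP_holds ℂ`), and `NP ⊆ NP/poly` (`NP_subset_polyAdvice_NP` with
`NP_closed_boolUnpair_fst_holds`), so `NP ⊆ P/poly`. [cite: Burgisser2000TCS, Cor. 1.2(1) p. 74] -/
@[summit_bridge "ValiantsHypothesis.ValiantsHypothesis"]
theorem erhAndNPNotSubsetPPoly_implies : ERHAndNPNotSubsetPPoly → _root_.ValiantsHypothesis := by
  rintro ⟨hERH, hNP⟩
  have hNP' : ¬ (Literature.Computability.Complexity.Nondeterministic.NP ⊆
      Literature.Computability.Complexity.PPoly) := hNP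
  show VP ℂ ≠ VNP ℂ
  intro hEq
  apply hNP'
  intro L hL
  have hPPoly : Literature.Computability.Complexity.PPoly =
      Literature.Computability.Complexity.polyAdvice Literature.Computability.Complexity.Nondeterministic.NP :=
    PPoly_eq_polyAdvice_NP_of_VP_eq_VNP_holds ℂ hERH hEq
  rw [hPPoly]
  exact Literature.Computability.Complexity.NP_subset_polyAdvice_NP
    Literature.Computability.Complexity.NP_closed_boolUnpair_fst_holds hL

/-- PRINTED bridge — **GRH ∧ `PP ⊄ P/poly` ⟹ Valiant's hypothesis over `ℂ`**; proved in Bürgisser,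
*Cook's versus Valiant's hypothesis*, TCS 235 (2000), Cor. 1.2(1), p. 74 (book: Bürgisser 2000, Thm. 4.5
and Cor. 4.6(1)): "We assume (GRH). If Valiant's hypothesis were false over a field of characteristic
zero, then we had `NC³/poly = P/poly = NP/poly = PH/poly` and `#P/poly = FP/poly`", and `#P/poly = FP/poly`
puts `PP` (threshold of a `#P` count) into `P/poly`. Named fact (D-0014), to be discharged as
`theorem ERHAndPPNotSubsetPPolyImpliesValiantsHypothesis_holds`; the tree's transfer machinery
(`ValiantBooleanBridgeBurgisserProofs`, `BurgisserBooleanParts*`, `Valiant1979_per01Plain_isSharpPHardFun`)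
covers everything but the `#P`/`PP` bookkeeping. [cite: Burgisser2000TCS, Cor. 1.2(1) p. 74] -/
@[summit_bridge "ValiantsHypothesis.ValiantsHypothesis"]
def ERHAndPPNotSubsetPPolyImpliesValiantsHypothesis : Prop :=
  ERHAndPPNotSubsetPPoly → _root_.ValiantsHypothesis

/-! ### Criteria -/

/-- **`PER` not p-computable over `ℂ` ⟺ Valiant's hypothesis over `ℂ`** (von zur Gathen 1987 Prop. 4.8
with Thm. 5.4; Bürgisser 2000 Rem. 2.11): the tree's `perNotPComputableComplex_iff_holds`, verbatim.
[cite: Vonzurgathen1987Feasible, Prop. 4.8] -/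
@[summit_bridge "ValiantsHypothesis.ValiantsHypothesis"]
theorem perNotPComputableComplex_iff : PerNotPComputableComplex ↔ _root_.ValiantsHypothesis :=
  perNotPComputableComplex_iff_holds

/-- **`HC` not p-computable over `ℂ` ⟺ Valiant's hypothesis over `ℂ`** (von zur Gathen 1987 Prop. 4.8
with Thm. 5.6): `VP_ne_VNP_iff_not_isPComputable_hcPoly` at the discharged `VNP`-completeness of `HC`
(`isVNPComplete_hcPoly_holds`). [cite: Vonzurgathen1987Feasible, Prop. 4.8 with Thm. 5.6] -/
@[summit_bridge "ValiantsHypothesis.ValiantsHypothesis"]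
theorem hcNotPComputableComplex_iff : HCNotPComputableComplex ↔ _root_.ValiantsHypothesis :=
  (VP_ne_VNP_iff_not_isPComputable_hcPoly ℂ (isVNPComplete_hcPoly_holds (k := ℂ))).symm

/-- Extension of scalars is free: a p-bounded circuit family for `(per_n)` over `ℝ` is one over `ℂ`
(`ArithCircuit.complexity_map_le` along `algebraMap ℝ ℂ`, `map_perPoly`; Bürgisser 2000 §4.1).
[cite: Burgisser2000, §4.1] -/
theorem isPComputable_perPoly_complex_of_real
    (h : IsPComputable (fun n => perPoly (Fin n) ℝ)) : IsPComputable (fun n => perPoly (Fin n) ℂ) := by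
  obtain ⟨c, hc⟩ := h
  refine ⟨c, fun n => le_trans ?_ (hc n)⟩
  have hmap := ArithCircuit.complexity_map_le (algebraMap ℝ ℂ) (perPoly (Fin n) ℝ)
  rwa [map_perPoly] at hmap

/-- **`PER` not p-computable over `ℝ` ⟺ Valiant's hypothesis over `ℂ`**: `IsPComputable` for the
permanent over `ℝ` and over `ℂ` are equivalent (scalar extension `isPComputable_perPoly_complex_of_real`;
realification `SymmetroidDescartes.isPComputable_perPoly_real_of_complex`, Hrubeš–Yehudayoff 2011 Thm.
4.2), and over `ℂ` this is `perNotPComputableComplex_iff_holds` (Bürgisser 2000 Rem. 2.11, §4.1).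
[cite: Burgisser2000, Rem. 2.11 with §4.1] -/
@[summit_bridge "ValiantsHypothesis.ValiantsHypothesis"]
theorem perNotPComputableReal_iff : PerNotPComputableReal ↔ _root_.ValiantsHypothesis :=
  (not_congr ⟨isPComputable_perPoly_complex_of_real,
    Summit.ValiantsHypothesis.ValiantsHypothesis.Theorems.SymmetroidDescartes.isPComputable_perPoly_real_of_complex⟩).trans
    perNotPComputableComplex_iff_holds

end Summit.ValiantsHypothesis.StrongHypotheses

end
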